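import Literature.AlgebraicGeometry.AbelianSchemes.PolarizedAbelianSchemeWithLevelBaseChangeUnique
import HarnessLib

/-!
# Pull-back relations of triples CANCEL: a relation along `t ≫ f₂` factors through a relation along `f₂` by a relation
# along `t` ([MumfordFogartyKirwan1994, Def. 7.2]: «`𝒜_{g,d,n}` … a contravariant FUNCTOR»)

Topic `AlgebraicGeometry/AbelianSchemes`; namespaces `…AbelianSchemeOver`, `…AbelianSchemeOver.LevelStructure`,
`…PolarizedAbelianSchemeWithLevel`.  Cell hodgecm-mathlib (D-0151), hand (h7)(D-F3) sequel; consumer: the cocycle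
condition of transition isomorphisms of triples on TRIPLE overlaps (F-8 (8c): the lifted transition maps `relativeT' i j k`
of ★ `Morphisms/GlueDataRelative` are relations along `D.t' i j k` by cancelling the slice relations), and every
«compare two charts of the same family over different bases» step.  THEOREMS ONLY (no def, no instance, no notation, no
`sorry`).  Generalises ★ `PolarizedAbelianSchemeWithLevelBaseChangeUnique.isBaseChangeVia_id_of_comp_eq` (the case
`t = 𝟙`, `m` an isomorphism) to an arbitrary `t : T₁ → T₂`.

Setting: `A/S`; `G₂ : A₂ → A` a base change of group schemes along `f₂ : T₂ → S` (`h₂`), `G₁ : A₁ → A` one along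
`t ≫ f₂` (`h₁`), and `m : A₁ → A₂` with `m ≫ G₂ = G₁` and `m ≫ π₂ = π₁ ≫ t` (such an `m` exists and is unique because
`(G₂, π₂)` is cartesian — `exists_comp_eq_of_comp`, `comp_eq_unique`).

* §1 `AbelianSchemeOver.isBaseChangeVia_of_comp` — `m` is a base change of group schemes along `t` (cartesian by pull-back
  cancellation, Mathlib `IsPullback.of_right`; unit and law clauses checked after `G₂` and after `π₂`, i.e. as maps into
  the pull-back `A₂ = A ×_S T₂`);
* §2 `LevelStructure.isBaseChangeVia_of_comp` — the level sections follow (`σ₁ᵢ ≫ m = t ≫ σ₂ᵢ` into `A₂ = A ×_S T₂`);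
* §3 **`PolarizedAbelianSchemeWithLevel.isBaseChangeVia_of_comp`** — all five clauses for `(m, m̂)`: the `X̂`-clause by §1
  for the duals, the Poincaré clause `(m × m̂)^*𝒫₂ ≅ (m × mh)^*(G₂ × Ĝ₂)^*𝒫 = (G₁ × Ĝ₁)^*𝒫 ≅ 𝒫₁`, the `λ`-clause into
  `X̂₂ = X̂ ×_S T₂`; and `exists_isBaseChangeVia_of_comp` (with the lifts as `m`, `m̂`).

HC_CM is proved only modulo the printed citations until rung 0 closes; this file discharges none of them.

## References
* [MumfordFogartyKirwan1994] D. Mumford, J. Fogarty, F. Kirwan, *Geometric Invariant Theory*, 3rd ed. (1994), Ch. 7 §2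
  Def. 7.2 (p. 129), Def. 7.3 (p. 129).
* [GortzWedhorn2020] U. Görtz, T. Wedhorn, *Algebraic Geometry I*, 2nd ed. (2020), Prop. 4.16 (p. 101); Section (4.7)
  (pp. 107–108).
-/

noncomputable section

universe u

open CategoryTheory CategoryTheory.Limits AlgebraicGeometry MonoidalCategory CartesianMonoidalCategory
open scoped MonObj

namespace Literature.AlgebraicGeometry.AbelianSchemes

namespace AbelianSchemeOver

variable {S T₁ T₂ : Scheme.{u}} {A : AbelianSchemeOver S} {A₁ : AbelianSchemeOver T₁} {A₂ : AbelianSchemeOver T₂}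
  {f₂ : T₂ ⟶ S} {t : T₁ ⟶ T₂} {G₁ : A₁.X.left ⟶ A.X.left} {G₂ : A₂.X.left ⟶ A.X.left}

/-! ### §1 Group schemes -/

/-- **The comparison map exists**: `A₂ = A ×_S T₂` is cartesian, so `(G₁, π₁ ≫ t)` factors through it.
[cite: GortzWedhorn2020, Prop. 4.16 (p. 101)] -/
theorem IsBaseChangeVia.exists_comp_eq_of_comp (h₁ : A₁.IsBaseChangeVia A (t ≫ f₂) G₁) (h₂ : A₂.IsBaseChangeVia A f₂ G₂) :
    ∃ m : A₁.X.left ⟶ A₂.X.left, m ≫ G₂ = G₁ ∧ m ≫ A₂.X.hom = A₁.X.hom ≫ t := by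
  obtain ⟨w₁, -, -, -⟩ := h₁
  obtain ⟨-, hpb₂, -, -⟩ := h₂
  exact ⟨hpb₂.lift G₁ (A₁.X.hom ≫ t) (by rw [w₁, Category.assoc]), hpb₂.lift_fst _ _ _, hpb₂.lift_snd _ _ _⟩

/-- **… and is unique.** [cite: GortzWedhorn2020, Prop. 4.16 (p. 101)] -/
theorem IsBaseChangeVia.comp_eq_unique (h₂ : A₂.IsBaseChangeVia A f₂ G₂) {m m' : A₁.X.left ⟶ A₂.X.left}
    (hmG : m ≫ G₂ = G₁) (hmπ : m ≫ A₂.X.hom = A₁.X.hom ≫ t) (hmG' : m' ≫ G₂ = G₁)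
    (hmπ' : m' ≫ A₂.X.hom = A₁.X.hom ≫ t) : m = m' := by
  obtain ⟨-, hpb₂, -, -⟩ := h₂
  exact hpb₂.hom_ext (hmG.trans hmG'.symm) (hmπ.trans hmπ'.symm)

/-- **PULL-BACK SQUARES OF GROUP SCHEMES CANCEL**: if `G₂ : A₂ → A` is a base change along `f₂`, `G₁ : A₁ → A` one
along `t ≫ f₂`, and `m : A₁ → A₂` satisfies `m ≫ G₂ = G₁`, `m ≫ π₂ = π₁ ≫ t`, then `m` is a base change of group
schemes along `t` — cartesian by Mathlib `IsPullback.of_right`, unit and law clauses read inside the pull-back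
`A₂ = A ×_S T₂` (after `G₂`: the clauses of `G₁`, `G₂`; after `π₂`: over the bases). [cite: MumfordFogartyKirwan1994, Ch. 7 §2 Definition 7.2 (p. 129)]
[cite: GortzWedhorn2020, Prop. 4.16 (p. 101) and Section (4.7) (pp. 107–108)] -/
theorem isBaseChangeVia_of_comp (h₁ : A₁.IsBaseChangeVia A (t ≫ f₂) G₁) (h₂ : A₂.IsBaseChangeVia A f₂ G₂)
    (m : A₁.X.left ⟶ A₂.X.left) (hmG : m ≫ G₂ = G₁) (hmπ : m ≫ A₂.X.hom = A₁.X.hom ≫ t) :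
    A₁.IsBaseChangeVia A₂ t m := by
  obtain ⟨w₁, hpb₁, hη₁, hμ₁⟩ := h₁
  obtain ⟨w₂, hpb₂, hη₂, hμ₂⟩ := h₂
  have hpb : IsPullback m A₁.X.hom A₂.X.hom t :=
    IsPullback.of_right (hmG.symm ▸ hpb₁) hmπ hpb₂
  refine ⟨hmπ, hpb, ?_, ?_⟩
  · -- units: compare after `G₂` and after `π₂`
    have l : (η[A₁.X].left ≫ m) ≫ G₂ = (t ≫ f₂) ≫ η[A.X].left := by
      erw [Category.assoc, hmG]; exact hη₁
    have r : (t ≫ η[A₂.X].left) ≫ G₂ = (t ≫ f₂) ≫ η[A.X].left := by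
      erw [Category.assoc, hη₂]; exact (Category.assoc _ _ _).symm
    have l' : (η[A₁.X].left ≫ m) ≫ A₂.X.hom = (𝟙_ (Over T₁)).hom ≫ t := by
      erw [Category.assoc, hmπ, ← Category.assoc, Over.w η[A₁.X]]
    have r' : (t ≫ η[A₂.X].left) ≫ A₂.X.hom = (𝟙_ (Over T₁)).hom ≫ t := by
      erw [Category.assoc, Over.w η[A₂.X]]
      exact (Category.comp_id t).trans (Category.id_comp t).symm
    exact hpb₂.hom_ext (l.trans r.symm) (l'.trans r'.symm)
  · -- multiplications: compare after `G₂` and after `π₂`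
    have hmaps : pullback.map A₁.X.hom A₁.X.hom A₂.X.hom A₂.X.hom m m t hmπ.symm hmπ.symm ≫
          pullback.map A₂.X.hom A₂.X.hom A.X.hom A.X.hom G₂ G₂ f₂ w₂.symm w₂.symm =
        pullback.map A₁.X.hom A₁.X.hom A.X.hom A.X.hom G₁ G₁ (t ≫ f₂) w₁.symm w₁.symm := by
      apply pullback.hom_ext
      · simp only [Category.assoc, pullback.lift_fst, pullback.lift_fst_assoc, hmG]
      · simp only [Category.assoc, pullback.lift_snd, pullback.lift_snd_assoc, hmG]
    have l : (μ[A₁.X].left ≫ m) ≫ G₂ =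
        pullback.map A₁.X.hom A₁.X.hom A.X.hom A.X.hom G₁ G₁ (t ≫ f₂) w₁.symm w₁.symm ≫ μ[A.X].left := by
      erw [Category.assoc, hmG]; exact hμ₁
    have r : (pullback.map A₁.X.hom A₁.X.hom A₂.X.hom A₂.X.hom m m t hmπ.symm hmπ.symm ≫ μ[A₂.X].left) ≫ G₂ =
        pullback.map A₁.X.hom A₁.X.hom A.X.hom A.X.hom G₁ G₁ (t ≫ f₂) w₁.symm w₁.symm ≫ μ[A.X].left := by
      erw [Category.assoc, hμ₂, ← Category.assoc, hmaps]
    have l' : (μ[A₁.X].left ≫ m) ≫ A₂.X.hom = (A₁.X ⊗ A₁.X).hom ≫ t := by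
      erw [Category.assoc, hmπ, ← Category.assoc, Over.w μ[A₁.X]]
    have r' : (pullback.map A₁.X.hom A₁.X.hom A₂.X.hom A₂.X.hom m m t hmπ.symm hmπ.symm ≫ μ[A₂.X].left) ≫
        A₂.X.hom = (A₁.X ⊗ A₁.X).hom ≫ t := by
      erw [Category.assoc, Over.w μ[A₂.X], Over.tensorObj_hom, Over.tensorObj_hom, pullback.lift_fst_assoc,
        Category.assoc, hmπ, Category.assoc]
      rfl
    exact hpb₂.hom_ext (l.trans r.symm) (l'.trans r'.symm)

/-! ### §2 Level structures -/

namespace LevelStructure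

variable {g n : ℕ} {φ : A.LevelStructure g n} {φ₁ : A₁.LevelStructure g n} {φ₂ : A₂.LevelStructure g n}

/-- **Pull-back relations of level structures cancel**: the sections satisfy `σ₁ᵢ ≫ m = t ≫ σ₂ᵢ` (checked in
`A₂ = A ×_S T₂`: after `G₂` both are `(t ≫ f₂) ≫ σᵢ`, over `T₂` both are `t`). [cite: MumfordFogartyKirwan1994, Ch. 7 §2 Definition 7.2 (p. 129)] -/
theorem isBaseChangeVia_of_comp (h₁ : φ₁.IsBaseChangeVia φ (t ≫ f₂) G₁) (h₂ : φ₂.IsBaseChangeVia φ f₂ G₂)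
    (m : A₁.X.left ⟶ A₂.X.left) (hmG : m ≫ G₂ = G₁) (hmπ : m ≫ A₂.X.hom = A₁.X.hom ≫ t) :
    φ₁.IsBaseChangeVia φ₂ t m := by
  refine ⟨AbelianSchemeOver.isBaseChangeVia_of_comp h₁.1 h₂.1 m hmG hmπ, fun i => ?_⟩
  obtain ⟨-, hpb₂, -, -⟩ := h₂.1
  have l : ((φ₁.σ i).left ≫ m) ≫ G₂ = (t ≫ f₂) ≫ (φ.σ i).left := by
    erw [Category.assoc, hmG]; exact h₁.2 i
  have r : (t ≫ (φ₂.σ i).left) ≫ G₂ = (t ≫ f₂) ≫ (φ.σ i).left := by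
    erw [Category.assoc, h₂.2 i]; exact (Category.assoc _ _ _).symm
  have l' : ((φ₁.σ i).left ≫ m) ≫ A₂.X.hom = (𝟙_ (Over T₁)).hom ≫ t := by
    erw [Category.assoc, hmπ, ← Category.assoc, Over.w (φ₁.σ i)]
  have r' : (t ≫ (φ₂.σ i).left) ≫ A₂.X.hom = (𝟙_ (Over T₁)).hom ≫ t := by
    erw [Category.assoc, Over.w (φ₂.σ i)]
    exact (Category.comp_id t).trans (Category.id_comp t).symm
  exact hpb₂.hom_ext (l.trans r.symm) (l'.trans r'.symm)

end LevelStructure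

end AbelianSchemeOver

/-! ### §3 Triples -/

namespace PolarizedAbelianSchemeWithLevel

open AbelianSchemeOver

variable {g N : ℕ} {δ : Fin g → ℕ} {S T₁ T₂ : Scheme.{u}} {P : PolarizedAbelianSchemeWithLevel g N δ S}
  {P₁ : PolarizedAbelianSchemeWithLevel g N δ T₁} {P₂ : PolarizedAbelianSchemeWithLevel g N δ T₂} {f₂ : T₂ ⟶ S}
  {t : T₁ ⟶ T₂} {G₁ : P₁.A.X.left ⟶ P.A.X.left} {Ĝ₁ : P₁.D.hat.X.left ⟶ P.D.hat.X.left}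
  {G₂ : P₂.A.X.left ⟶ P.A.X.left} {Ĝ₂ : P₂.D.hat.X.left ⟶ P.D.hat.X.left}

/-- **PULL-BACK RELATIONS OF TRIPLES CANCEL** ([MumfordFogartyKirwan1994] Def. 7.2: `𝒜(t ≫ f₂) = 𝒜(t) ∘ 𝒜(f₂)` on the
relation level): if `(G₂, Ĝ₂)` exhibits `P₂` as the pull-back of `P` along `f₂` and `(G₁, Ĝ₁)` exhibits `P₁` as the
pull-back along `t ≫ f₂`, then the comparison maps `m : X₁ → X₂`, `m̂ : X̂₁ → X̂₂` (`m ≫ G₂ = G₁`, `m̂ ≫ Ĝ₂ = Ĝ₁`, both over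
`t`) exhibit `P₁` as the pull-back of `P₂` along `t`: `X`/level/`X̂` by §§1–2, Poincaré
`(m × m̂)^*𝒫₂ ≅ (m × mh)^*(G₂ × Ĝ₂)^*𝒫 ≅ (G₁ × Ĝ₁)^*𝒫 ≅ 𝒫₁`, `λ` inside `X̂₂ = X̂ ×_S T₂`.
[cite: MumfordFogartyKirwan1994, Ch. 7 §2 Definition 7.2 (p. 129) and Definition 7.3 (p. 129)] [cite: GortzWedhorn2020, Prop. 4.16 (p. 101)] -/
theorem isBaseChangeVia_of_comp (h₁ : P₁.IsBaseChangeVia P (t ≫ f₂) G₁ Ĝ₁) (h₂ : P₂.IsBaseChangeVia P f₂ G₂ Ĝ₂)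
    (m : P₁.A.X.left ⟶ P₂.A.X.left) (mh : P₁.D.hat.X.left ⟶ P₂.D.hat.X.left) (hmG : m ≫ G₂ = G₁)
    (hmπ : m ≫ P₂.A.X.hom = P₁.A.X.hom ≫ t) (hmhG : mh ≫ Ĝ₂ = Ĝ₁)
    (hmhπ : mh ≫ P₂.D.hat.X.hom = P₁.D.hat.X.hom ≫ t) : P₁.IsBaseChangeVia P₂ t m mh := by
  obtain ⟨hl₁, hh₁, ⟨wG₁, wĜ₁, ⟨e₁⟩⟩, hlam₁⟩ := h₁
  obtain ⟨hl₂, hh₂, ⟨wG₂, wĜ₂, ⟨e₂⟩⟩, hlam₂⟩ := h₂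
  obtain ⟨-, hpbh₂, -, -⟩ := id hh₂
  refine ⟨LevelStructure.isBaseChangeVia_of_comp hl₁ hl₂ m hmG hmπ,
    AbelianSchemeOver.isBaseChangeVia_of_comp hh₁ hh₂ mh hmhG hmhπ, ⟨hmπ.symm, hmhπ.symm, ⟨?_⟩⟩, ?_⟩
  · -- Poincaré
    have hcomp : pullback.map P₁.A.X.hom P₁.D.hat.X.hom P₂.A.X.hom P₂.D.hat.X.hom m mh t hmπ.symm hmhπ.symm ≫
          pullback.map P₂.A.X.hom P₂.D.hat.X.hom P.A.X.hom P.D.hat.X.hom G₂ Ĝ₂ f₂ wG₂ wĜ₂ =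
        pullback.map P₁.A.X.hom P₁.D.hat.X.hom P.A.X.hom P.D.hat.X.hom G₁ Ĝ₁ (t ≫ f₂) wG₁ wĜ₁ := by
      apply pullback.hom_ext
      · rw [Category.assoc, pullback.lift_fst, ← Category.assoc, pullback.lift_fst, Category.assoc, hmG,
          pullback.lift_fst]
      · rw [Category.assoc, pullback.lift_snd, ← Category.assoc, pullback.lift_snd, Category.assoc, hmhG,
          pullback.lift_snd]
    exact (Scheme.Modules.pullback
        (pullback.map P₁.A.X.hom P₁.D.hat.X.hom P₂.A.X.hom P₂.D.hat.X.hom m mh t hmπ.symm hmhπ.symm)).mapIso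
          e₂.symm ≪≫
      (Scheme.Modules.pullbackComp
        (pullback.map P₁.A.X.hom P₁.D.hat.X.hom P₂.A.X.hom P₂.D.hat.X.hom m mh t hmπ.symm hmhπ.symm)
        (pullback.map P₂.A.X.hom P₂.D.hat.X.hom P.A.X.hom P.D.hat.X.hom G₂ Ĝ₂ f₂ wG₂ wĜ₂)).app P.D.P ≪≫
      (Scheme.Modules.pullbackCongr hcomp).app P.D.P ≪≫ e₁
  · -- `λ`: compare after `Ĝ₂` and over `T₂`, i.e. as maps into `X̂₂ = X̂ ×_S T₂`
    apply hpbh₂.hom_ext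
    · rw [Category.assoc, hmhG, hlam₁, Category.assoc, hlam₂, ← Category.assoc, hmG]
    · rw [Category.assoc, hmhπ, ← Category.assoc, Over.w P₁.pol.lam, Category.assoc, Over.w P₂.pol.lam, hmπ]

/-- **Existence form**: the comparison maps exist (lifts through the cartesian squares of `P₂`), so a relation along
`t ≫ f₂` and one along `f₂` into the same triple yield a relation along `t`. [cite: MumfordFogartyKirwan1994, Ch. 7 §2 Definition 7.2 (p. 129)]
[cite: GortzWedhorn2020, Prop. 4.16 (p. 101)] -/
theorem exists_isBaseChangeVia_of_comp (h₁ : P₁.IsBaseChangeVia P (t ≫ f₂) G₁ Ĝ₁) (h₂ : P₂.IsBaseChangeVia P f₂ G₂ Ĝ₂) :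
    ∃ (m : P₁.A.X.left ⟶ P₂.A.X.left) (mh : P₁.D.hat.X.left ⟶ P₂.D.hat.X.left),
      m ≫ G₂ = G₁ ∧ mh ≫ Ĝ₂ = Ĝ₁ ∧ P₁.IsBaseChangeVia P₂ t m mh := by
  obtain ⟨m, hmG, hmπ⟩ := h₁.1.1.exists_comp_eq_of_comp h₂.1.1
  obtain ⟨mh, hmhG, hmhπ⟩ := h₁.2.1.exists_comp_eq_of_comp h₂.2.1
  exact ⟨m, mh, hmG, hmhG, isBaseChangeVia_of_comp h₁ h₂ m mh hmG hmπ hmhG hmhπ⟩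

end PolarizedAbelianSchemeWithLevel

end Literature.AlgebraicGeometry.AbelianSchemes

end
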